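import Literature.AlgebraicGeometry.HodgeTheory.HypersurfaceSectionHodgeConjecture
import Literature.AlgebraicGeometry.Motives.UniversalHyperplaneSectionFibreSection
import HarnessLib

/-!
# The weak Lefschetz package for the smooth members of the universal hyperplane section
# (`UniversalSectionLefschetzPackage` proved; Voisin II Thm. 1.23 on the universal family)

Topic `Literature/AlgebraicGeometry/HodgeTheory` (theorems only; no definitions, no named facts).
Cell `hodge-nonav`, ROUTE-P1O §5 item S-LEF1.

`HypersurfaceSectionHC.UniversalSectionLefschetzPackage k N X ι` (file
`HypersurfaceSectionHodgeConjecture`, §F) asks, for every `H ∈ (ℙᴺ)^*(ℂ)` whose member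
`X ∩ H := π⁻¹[H]` of the universal hyperplane section `π : 𝒳 ⟶ (ℙᴺ)^*` of `ι : X ⟶ ℙᴺ_ℂ` is smooth
projective of dimension `2k`, that restriction along `X ∩ H ⟶ 𝒳 ⟶ X` be bijective on `Hʲ(·(ℂ); ℂ)`
for `j < 2k` and injective on `H²ᵏ`. We PROVE it for `X` smooth projective of dimension `2k + 1` and
`ι` a closed immersion (`e : ProjectiveEmbedding X`, `N = e.n`, `ι = e.ι`):

* `universalSectionLefschetzPackage` — the package. Proof = Voisin II Thm. 1.23 verbatim on the
  universal family: the member `π⁻¹[a] ⟶ X` is a closed immersion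
  (`UniversalHyperplaneSection.isClosedImmersion_fiberι_proj_toX_left`) with the same complex points
  in `X(ℂ)` as the hyperplane section `X ∩ V₊(ℓ_a)` (`range_map_fiberι_proj_toX_eq`), so the
  complement `X(ℂ) ∖ π⁻¹[a](ℂ)` has no homology in degrees `≥ 2k + 3 = dim_ℝ/2 + 1`
  (Andreotti–Frankel / Thm. 1.22, tree theorem
  `HypersurfaceSectionComplement.isZero_singularHomology_compl_range_hypersurfaceSectionι`), and the
  two duality steps (`injective_/surjective_complexBettiMap_of_isZero_singularHomology_compl_range`)
  give bijectivity below the middle and injectivity in the middle. No identification of the member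
  with the zero SCHEME `X ∩ V₊(ℓ_a)` is needed (only of their complex points).
* `universalSectionLefschetzPackage_of_isClosedImmersion` — the same for a bare closed immersion
  `ι : X ⟶ ℙᴺ_ℂ`.
* `veryGeneralSection_hodgeConjectureFor'` — ROW CL-LEF2 of ROUTE-P1O with the package DISCHARGED:
  `X ⊂ ℙᴺ` smooth projective of dimension `2k + 1` with HC(X) and (VG)
  `VeryGeneralSectionHodgeClassesFromAmbient k N X ι` ⇒ for all `H` in a residual set, `X ∩ H` smooth
  of dimension `2k` ⇒ HC(X ∩ H) (still modulo the summit-side Fulton hypothesis `hFul`).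

## References

* [VoisinHodgeII2003] C. Voisin, Hodge Theory and Complex Algebraic Geometry II (2003), §1.2.2
  Thm. 1.22–1.23 (PDF pp. 59–61), §2.3.1 (members of the universal family = hyperplane sections).
* [Voisin2013HodgeLociSurvey] C. Voisin, Hodge loci, §4.3 Thm. 4.17, Rem. 4.18 (p. 19).
-/

noncomputable section

open CategoryTheory AlgebraicGeometry Filter
open Literature.AlgebraicGeometry.Motives
open Literature.AlgebraicGeometry.HodgeTheory
open Literature.AlgebraicTopology.SingularHomology

namespace Literature.AlgebraicGeometry.HodgeTheory.HypersurfaceSectionHC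

/-- **The weak Lefschetz package for the smooth members of the universal hyperplane section**
(Voisin II Thm. 1.23 on the universal family): for `X` smooth projective of dimension `2k + 1` with a
projective embedding `e : X ↪ ℙᴺ_ℂ`, every `H ∈ (ℙᴺ)^*(ℂ)` with `X ∩ H = π⁻¹[H]` smooth projective of
dimension `2k` has `Hʲ(X(ℂ); ℂ) → Hʲ((X ∩ H)(ℂ); ℂ)` bijective for `j < 2k` and injective for
`j = 2k`. [cite: VoisinHodgeII2003, §1.2.2 Thm. 1.23 (PDF p. 60) with §2.3.1] -/
theorem universalSectionLefschetzPackage {k : ℕ} {X : SchemeOver ℂ}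
    (hX : IsSmoothProjective (2 * k + 1) X) (e : ProjectiveEmbedding X) :
    UniversalSectionLefschetzPackage k e.n X e.ι := by
  intro H hU
  have hY : IsSmoothProjective (2 * k) (fiberOver (UniversalHyperplaneSection.proj e.n e.ι) H) := hU
  obtain ⟨a, ha, rfl⟩ := ProjectiveSpace.exists_eq_pointOfVec H
  haveI : LocallyOfFiniteType X.hom := by rw [← Over.w e.ι]; infer_instance
  haveI := UniversalHyperplaneSection.isClosedImmersion_fiberι_proj_toX_left e a ha
  -- Andreotti–Frankel for the complement of the member, through its complex points in `X(ℂ)`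
  have hAF : ∀ {j : ℕ}, 2 * k + 2 ≤ j → Limits.IsZero (singularHomology ℂ ℂ
      ↥(Set.range (AlgPoints.map (L := ℂ)
        (fiberι (UniversalHyperplaneSection.proj e.n e.ι) (ProjectiveSpace.pointOfVec ℂ a ha) ≫
          UniversalHyperplaneSection.toX e.n e.ι)) :
        Set (ComplexPoints X))ᶜ j) := by
    intro j hj
    rw [UniversalHyperplaneSection.range_map_fiberι_proj_toX_eq e a ha]
    exact HypersurfaceSectionComplement.isZero_singularHomology_compl_range_hypersurfaceSectionι
      (R := ℂ) (M₀ := ℂ) hX e le_rfl (linForm e.n a) (isHomogeneous_linForm e.n a) hj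
  refine ⟨fun j hj ↦ ⟨?_, ?_⟩, ?_⟩
  · exact injective_complexBettiMap_of_isZero_singularHomology_compl_range hX hY _
      (j := 2 * (2 * k + 1) - j) (by omega) (hAF (by omega))
  · exact surjective_complexBettiMap_of_isZero_singularHomology_compl_range hX hY _
      (j := 2 * (2 * k + 1) - 1 - j) (by omega) (hAF (by omega))
  · exact injective_complexBettiMap_of_isZero_singularHomology_compl_range hX hY _
      (j := 2 * (2 * k + 1) - 2 * k) (by omega) (hAF (by omega))

/-- The weak Lefschetz package for the universal hyperplane section of a bare closed immersion
`ι : X ⟶ ℙᴺ_ℂ`, `X` smooth projective of dimension `2k + 1`. [cite: VoisinHodgeII2003, §1.2.2 Thm. 1.23 (PDF p. 60) with §2.3.1] -/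
theorem universalSectionLefschetzPackage_of_isClosedImmersion {k N : ℕ} {X : SchemeOver ℂ}
    (hX : IsSmoothProjective (2 * k + 1) X) (ι : X ⟶ projectiveSpace N ℂ)
    [IsClosedImmersion ι.left] : UniversalSectionLefschetzPackage k N X ι :=
  universalSectionLefschetzPackage hX ⟨N, ι, inferInstance⟩

/-- **ROW CL-LEF2 of ROUTE-P1O with the Lefschetz package discharged**: for `X ⊂ ℙᴺ_ℂ` smooth
projective of dimension `2k + 1` (closed immersion `ι`) satisfying the Hodge conjecture and (VG) for
the very general hyperplane section, for all `H` in a residual subset of `(ℙᴺ)^*(ℂ)`: if `X ∩ H` is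
smooth of dimension `2k` then `X ∩ H` satisfies the Hodge conjecture (modulo the summit-side Fulton
hypothesis `hFul`). [cite: Voisin2013HodgeLociSurvey, §4.3 Thm. 4.17 with conditions (a), (b) and Rem. 4.18 (p. 19)] [cite: VoisinHodgeII2003, §1.2.2 Thm. 1.23] -/
theorem veryGeneralSection_hodgeConjectureFor' (hFul : fulton1998_map_mem_algebraicClasses)
    {k N : ℕ} {X : SchemeOver ℂ} (hX : IsSmoothProjective (2 * k + 1) X)
    (ι : X ⟶ projectiveSpace N ℂ) [IsClosedImmersion ι.left]
    (hVG : VeryGeneralSectionHodgeClassesFromAmbient k N X ι) (hHC : HodgeConjectureFor (2 * k + 1) X) :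
    ∀ᶠ H in residual (ComplexPoints (dualProjectiveSpace N ℂ)),
      H ∈ universalSmoothLocus N ι (2 * k) →
        HodgeConjectureFor (2 * k) (fiberOver (UniversalHyperplaneSection.proj N ι) H) :=
  veryGeneralSection_hodgeConjectureFor hFul hX ι hVG
    (universalSectionLefschetzPackage_of_isClosedImmersion hX ι) hHC

end Literature.AlgebraicGeometry.HodgeTheory.HypersurfaceSectionHC

end
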